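import Summits.AtomisticToContinuum.HydrodynamicLimit.Theorems.TwoClocksTransferEntropyClockOddWindowLLN
import HarnessLib

/-!
# The bounded odd window LLN reduces to a one-sided two-time autocorrelation decay (support file, stub S5′
# `stub_oddWindowLLN`, line `Sketch`, crux stmt-AtomisticToContinuum-16625 `TwoClocks.TransferEntropyClock`)

Stub S5′ `stub_oddWindowLLN : TransferEntropyClockOddWindowLLN.BoundedOddWindowLLN` (the landed node: tagged-particle window
LLN, in `L¹` and particle average, for bounded odd radial functionals `R(s, x_i, ‖W_i‖²) W_i` of the peculiar velocity
`W_i = v_i − u_s(x_i)` under the TRUE pre-shock law) stays OPEN — verdict `stub-blocked`: already at `s = 0` in global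
equilibrium it is a mean-ergodic theorem, uniform in `N`, for the velocity process of ONE tagged sphere of the deterministic
hard-sphere gas at fixed reduced density `σ³` (known only in the Boltzmann–Grad limit), and away from equilibrium it pins
the true local mean velocity at time `s` to the Euler field `u_s` (the momentum part of the hydrodynamic limit). No cheap
closure (the frame is satisfiable: constant Euler states, Alexander flows, `localGibbsLaw` a probability measure carried by
the good set, proved `t = 0` LLN; the tested quantity is `≤ |V|³` but free flight keeps it `O(1)` with probability
`≍ e^{−cτσ²}`), and no mis-statement found (`V ≤ 0`, `s = t`, `x`- and `s`-measurable weights all harmless).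

This file lands the kernel-checked REDUCTION of the node to the weakest dynamical input its proof consumes:
* §5 `OddPeculiarAutocorrelationDecay` — same frame and weights; the particle-averaged TWO-TIME correlation
  `E_P[(N+1)⁻¹ Σ_i ⟪F_i(s,r), F_i(s,r′)⟫]` of the tested functional is `≤ ε` (ONE-SIDED) for all `s ≤ r`,
  `r + ℓ(ε)(N+1)^{-1/3} ≤ r′ ≤ s + L(N+1)^{-1/3}`, once `N ≥ N₀(L)`;
* §6 **`boundedOddWindowLLN_of_autocorrelationDecay : OddPeculiarAutocorrelationDecay → BoundedOddWindowLLN`**: AM–GM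
  `E f ≤ ε/2 + E f²/(2ε)` and Cauchy–Schwarz in the particle index (no measurability of the node's integrand needed), the
  pathwise identity `‖∫_I F‖² = ∫∫_{I×I} ⟪F(r), F(r′)⟫` (§3) along the flow glued to the identity off its good set (§1, jointly
  measurable on phase space × time by `HardSphereFlow.measurable_flow_prod_torus`), Fubini for `localGibbsLaw ×` Lebesgue on
  the square (all bounded by `|V|⁶`; `localGibbsLaw` is a probability measure for `σ ≤ 1/2`), and the split of the square into
  the band `|r − r′| < ℓ(N+1)^{-1/3}` (measure `≤ 2ℓτ(N+1)^{-2/3}`, §4) and its complement (the hypothesis, both time orders):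
  `E f² ≤ ε²/2 + 2|V|⁶ℓ/τ ≤ ε²` for `τ ≥ τ₀ := ℓ + 4ℓ|V|⁶/ε²`.
-/

noncomputable section

open MeasureTheory Filter Set Topology
open scoped ENNReal

namespace Summit.AtomisticToContinuum.HydrodynamicLimit.Theorems.TransferEntropyClockOddWindowLLNNode

open Literature.MathematicalPhysics.KineticTheory Literature.Analysis.FluidPDE Literature.Analysis.FunctionSpaces
open Summit.AtomisticToContinuum.HydrodynamicLimit.Theorems.TransferEntropyClockOddWindowLLN (BoundedOddWindowLLN)

/-! ## §1 The flow glued to the identity off the good set: joint measurability -/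

variable {ε : ℝ} {n : ℕ}

open Classical in
/-- The hard-sphere flow glued to the identity off its good set (a jointly measurable version; the good set is
invariant and carries every law absolutely continuous w.r.t. Liouville). [folklore] -/
def goodFlow (Φ : HardSphereFlow (Torus.geometry (Fin 3)) ε n) (r : ℝ) (z : Config n (Fin 3) T3) :
    Config n (Fin 3) T3 :=
  if z ∈ Φ.good then Φ.flow r z else z

/-- On the good set the glued flow is the flow. [folklore] -/
theorem goodFlow_eq_of_mem (Φ : HardSphereFlow (Torus.geometry (Fin 3)) ε n) {z : Config n (Fin 3) T3}
    (hz : z ∈ Φ.good) (r : ℝ) : goodFlow Φ r z = Φ.flow r z := by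
  simp only [goodFlow, if_pos hz]

/-- **Joint measurability of the glued flow** `(z, r) ↦ Ψ_r z` on the whole phase space × time (from the joint
measurability of the flow on `good × ℝ`, `HardSphereFlow.measurable_flow_prod_torus`). [folklore] -/
theorem measurable_goodFlow_prod (Φ : HardSphereFlow (Torus.geometry (Fin 3)) ε n) :
    Measurable fun p : Config n (Fin 3) T3 × ℝ => goodFlow Φ p.2 p.1 := by
  have hs : MeasurableSet {p : Config n (Fin 3) T3 × ℝ | p.1 ∈ Φ.good} := measurable_fst Φ.measurableSet_good
  refine measurable_of_restrict_of_restrict_compl hs ?_ ?_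
  · have h1 : Measurable fun x : {p : Config n (Fin 3) T3 × ℝ | p.1 ∈ Φ.good} =>
        ((⟨(x : Config n (Fin 3) T3 × ℝ).1, x.2⟩ : Φ.good), (x : Config n (Fin 3) T3 × ℝ).2) :=
      (measurable_subtype_coe.fst.subtype_mk).prodMk measurable_subtype_coe.snd
    have h2 := (Φ.measurable_flow_prod_torus).comp h1
    convert h2 using 1
    funext x
    simp only [restrict_apply, Function.comp_apply]
    exact goodFlow_eq_of_mem Φ x.2 _
  · have h3 : Measurable fun x : ({p : Config n (Fin 3) T3 × ℝ | p.1 ∈ Φ.good}ᶜ : Set _) =>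
        (x : Config n (Fin 3) T3 × ℝ).1 := measurable_subtype_coe.fst
    convert h3 using 1
    funext x
    simp only [restrict_apply, goodFlow, if_neg (show (x : Config n (Fin 3) T3 × ℝ).1 ∉ Φ.good from x.2)]

/-! ## §2 The tested one-particle functional -/

/-- The tested one-particle functional `(x, v) ↦ R(x, ‖v − u(x)‖²) (v − u(x))` (odd in the peculiar velocity). [folklore] -/
def oddObs (uu : T3 → V3) (Rw : T3 → ℝ → ℝ) (q : T3 × V3) : V3 :=
  Rw q.1 (‖q.2 - uu q.1‖ ^ 2) • (q.2 - uu q.1)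

/-- The tested functional is measurable for a continuous velocity field and a measurable weight. [folklore] -/
theorem measurable_oddObs {uu : T3 → V3} (hu : Continuous uu) {Rw : T3 → ℝ → ℝ}
    (hRm : Measurable fun p : T3 × ℝ => Rw p.1 p.2) : Measurable (oddObs uu Rw) := by
  have hW : Measurable fun q : T3 × V3 => q.2 - uu q.1 := measurable_snd.sub (hu.measurable.comp measurable_fst)
  exact (hRm.comp (measurable_fst.prodMk (hW.norm.pow_const 2))).smul hW

/-- The tested functional of an admissible weight at level `V` is bounded by `|V|³`. [folklore] -/
theorem norm_oddObs_le {uu : T3 → V3} {Rw : T3 → ℝ → ℝ} {V : ℝ} (hR0 : ∀ x s', V ^ 2 < s' → Rw x s' = 0)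
    (hR : ∀ x s', |Rw x s'| ≤ |s'|) (q : T3 × V3) : ‖oddObs uu Rw q‖ ≤ |V| ^ 3 := by
  unfold oddObs
  rw [norm_smul, Real.norm_eq_abs]
  by_cases h : V ^ 2 < ‖q.2 - uu q.1‖ ^ 2
  · rw [hR0 _ _ h, abs_zero, zero_mul]; positivity
  · have h1 : ‖q.2 - uu q.1‖ ≤ |V| := by
      have := sq_le_sq.1 (not_lt.1 h)
      rwa [abs_of_nonneg (norm_nonneg _)] at this
    calc |Rw q.1 (‖q.2 - uu q.1‖ ^ 2)| * ‖q.2 - uu q.1‖ ≤ ‖q.2 - uu q.1‖ ^ 2 * ‖q.2 - uu q.1‖ :=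
          mul_le_mul_of_nonneg_right ((hR _ _).trans (abs_of_nonneg (sq_nonneg _)).le) (norm_nonneg _)
      _ = ‖q.2 - uu q.1‖ ^ 3 := by ring
      _ ≤ |V| ^ 3 := pow_le_pow_left₀ (norm_nonneg _) h1 3

/-! ## §3 The squared norm of a window integral as a double integral of two-time inner products -/

/-- The two-time inner-product kernel `(r, r′) ↦ ⟪F(r), F(r′)⟫` of a bounded measurable signal is integrable on the
product of two finite measures. [folklore] -/
theorem integrable_inner_prod {F : ℝ → V3} (hF : Measurable F) {B : ℝ} (hB : ∀ r, ‖F r‖ ≤ B)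
    (μ ν : Measure ℝ) [IsFiniteMeasure μ] [IsFiniteMeasure ν] :
    Integrable (fun p : ℝ × ℝ => inner ℝ (F p.1) (F p.2)) (μ.prod ν) := by
  refine (integrable_const (B * B)).mono'
    ((hF.comp measurable_fst).inner (hF.comp measurable_snd)).aestronglyMeasurable (ae_of_all _ fun p => ?_)
  rw [Real.norm_eq_abs]
  exact (abs_real_inner_le_norm _ _).trans
    (mul_le_mul (hB _) (hB _) (norm_nonneg _) ((norm_nonneg _).trans (hB p.1)))

/-- **`‖∫_I F‖² = ∫∫_{I×I} ⟪F(r), F(r′)⟫`** for a bounded measurable signal on a window `I = (s, s + w]`. [folklore] -/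
theorem sq_norm_setIntegral_eq {F : ℝ → V3} (hF : Measurable F) {B : ℝ} (hB : ∀ r, ‖F r‖ ≤ B) (s w : ℝ) :
    ‖∫ r in Ioc s (s + w), F r‖ ^ 2 = ∫ p : ℝ × ℝ, inner ℝ (F p.1) (F p.2)
      ∂((volume.restrict (Ioc s (s + w))).prod (volume.restrict (Ioc s (s + w)))) := by
  have hint : Integrable F (volume.restrict (Ioc s (s + w))) :=
    (integrable_const B).mono' hF.aestronglyMeasurable (ae_of_all _ hB)
  rw [← real_inner_self_eq_norm_sq]
  calc inner ℝ (∫ r in Ioc s (s + w), F r) (∫ r in Ioc s (s + w), F r)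
        = ∫ x in Ioc s (s + w), inner ℝ (∫ r in Ioc s (s + w), F r) (F x) := (integral_inner hint _).symm
    _ = ∫ x in Ioc s (s + w), ∫ r in Ioc s (s + w), inner ℝ (F x) (F r) := by
        congr 1
        funext x
        rw [real_inner_comm, ← integral_inner hint]
    _ = _ := (integral_prod _ (integrable_inner_prod hF hB _ _)).symm

/-- **The particle-averaged squared window average as a double time integral**: for bounded measurable signals `F_i`,
`a Σ_i ‖w⁻¹ ∫_s^{s+w} F_i‖² = w⁻² ∫∫_{I×I} a Σ_i ⟪F_i(r), F_i(r′)⟫`, `I = (s, s + w]`, `w ≥ 0`. [folklore] -/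
theorem mul_sum_sq_norm_windowAvg_eq {m : ℕ} {F : Fin m → ℝ → V3} (hF : ∀ i, Measurable (F i)) {B : ℝ}
    (hB : ∀ i r, ‖F i r‖ ≤ B) {s w : ℝ} (hw : 0 ≤ w) (a : ℝ) :
    a * ∑ i, ‖w⁻¹ • ∫ r in s..(s + w), F i r‖ ^ 2 =
      w⁻¹ ^ 2 * ∫ p : ℝ × ℝ, a * ∑ i, inner ℝ (F i p.1) (F i p.2)
        ∂((volume.restrict (Ioc s (s + w))).prod (volume.restrict (Ioc s (s + w)))) := by
  have hsw : s ≤ s + w := by linarith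
  rw [integral_const_mul, integral_finsetSum _ fun i _ => integrable_inner_prod (hF i) (hB i) _ _, Finset.mul_sum,
    Finset.mul_sum, Finset.mul_sum]
  refine Finset.sum_congr rfl fun i _ => ?_
  rw [intervalIntegral.integral_of_le hsw, norm_smul, mul_pow, Real.norm_eq_abs, abs_of_nonneg (inv_nonneg.2 hw),
    sq_norm_setIntegral_eq (hF i) (hB i) s w]
  ring

/-! ## §4 The near-diagonal band of the square has small measure -/

/-- The band `{|r − r′| < δ}` of the square `I × I`, `I = (s, s + w]`, has measure at most `2δw`. [folklore] -/
theorem prod_band_le (s w : ℝ) {δ : ℝ} (hδ : 0 ≤ δ) :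
    ((volume.restrict (Ioc s (s + w))).prod (volume.restrict (Ioc s (s + w))))
        {p : ℝ × ℝ | |p.1 - p.2| < δ} ≤ ENNReal.ofReal (2 * δ * w) := by
  have hD : MeasurableSet {p : ℝ × ℝ | |p.1 - p.2| < δ} :=
    (isOpen_lt (continuous_abs.comp (continuous_fst.sub continuous_snd)) continuous_const).measurableSet
  rw [Measure.prod_apply hD]
  have hslice : ∀ x : ℝ, (volume.restrict (Ioc s (s + w))) (Prod.mk x ⁻¹' {p : ℝ × ℝ | |p.1 - p.2| < δ}) ≤
      ENNReal.ofReal (2 * δ) := fun x => by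
    have hsub : Prod.mk x ⁻¹' {p : ℝ × ℝ | |p.1 - p.2| < δ} ⊆ Ioo (x - δ) (x + δ) := fun y hy => by
      simp only [mem_preimage, mem_setOf_eq, abs_sub_lt_iff] at hy
      constructor <;> linarith [hy.1, hy.2]
    calc _ ≤ volume (Prod.mk x ⁻¹' {p : ℝ × ℝ | |p.1 - p.2| < δ}) := Measure.restrict_le_self _
      _ ≤ volume (Ioo (x - δ) (x + δ)) := measure_mono hsub
      _ = ENNReal.ofReal (2 * δ) := by rw [Real.volume_Ioo]; ring_nf
  calc _ ≤ ∫⁻ _x, ENNReal.ofReal (2 * δ) ∂(volume.restrict (Ioc s (s + w))) := lintegral_mono hslice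
    _ = ENNReal.ofReal (2 * δ) * ENNReal.ofReal w := by
        rw [lintegral_const, Measure.restrict_apply_univ, Real.volume_Ioc]; ring_nf
    _ = ENNReal.ofReal (2 * δ * w) := by rw [← ENNReal.ofReal_mul (by positivity)]

/-! ## §5 The dynamical input: two-time autocorrelation decay of bounded odd peculiar-velocity functionals -/

/-- **Two-time autocorrelation decay of bounded odd functionals of the peculiar velocity of a tagged particle, under the
TRUE pre-shock law.** Frame and admissible weights of `TransferEntropyClockOddWindowLLN.BoundedOddWindowLLN`; tested
functional `F_i(s, r) = R(s, x_i(r), ‖W_i‖²) W_i`, `W_i(r) = v_i(r) − u_s(x_i(r))` (bounded by `|V|³`, odd in `W_i`).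
Statement: `∀ ε ∃ ℓ > 0 ∀ L ∃ N₀ ∀ N ≥ N₀ ∀ s ∈ [0, t] ∀ r r′`, if `s ≤ r`, `r + ℓ(N+1)^{-1/3} ≤ r′ ≤ s + L(N+1)^{-1/3}` then
`E_P[(N+1)⁻¹ Σ_i ⟪F_i(s, r), F_i(s, r′)⟫] ≤ ε` (`P = localGibbsLaw`): the particle-averaged (annealed tagged particle) time
autocorrelation of the functional is `≤ ε` at all lags beyond `ℓ(ε)` kinetic time units `(N+1)^{-1/3}` (`≍ ℓσ²` mean free
times), within any kinetic horizon `L(N+1)^{-1/3}` (over which the frozen Euler field `u_s` is the right centring), once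
`N ≥ N₀(L)`. ONE-SIDED (all the window LLN needs; hard-sphere velocity autocorrelations may turn negative — back-scattering)
and TWO-TIME (no window, no norm: a statement about the joint law at two fixed times). Physically: local equilibrium with
mean velocity `u_s` plus mixing of the one-particle peculiar-velocity process of the deterministic hard-sphere gas at fixed
reduced density `σ³` — conjecture-grade (known only in the Boltzmann–Grad limit). -/
def OddPeculiarAutocorrelationDecay : Prop :=
  ∀ (a₀ θ₀ : T3 → ℝ) (u₀ : T3 → V3), Continuous a₀ → Continuous θ₀ → Continuous u₀ →
    (∀ x, 0 < a₀ x) → (∀ x, 0 < θ₀ x) →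
    ∃ σ₀ : ℝ, 0 < σ₀ ∧ ∀ σ : ℝ, 0 < σ → σ < σ₀ →
    ∀ (T : ℝ) (ρ θ : ℝ → T3 → ℝ) (u : ℝ → T3 → V3), IsHardSphereEulerSolution σ T ρ u θ →
    ∀ Φ : (N : ℕ) → HardSphereFlow (Torus.geometry (Fin 3)) (hsDiameter σ N) (N + 1),
    TendstoHydroFieldsAt (fun N => localGibbsLaw σ a₀ u₀ θ₀ N (Φ N)) Φ ρ u θ 0 →
    ∀ t ∈ Set.Ico 0 T, ∀ V : ℝ,
    ∀ R : ℝ → T3 → ℝ → ℝ, Measurable (fun p : ℝ × T3 × ℝ => R p.1 p.2.1 p.2.2) →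
    (∀ s x s', V ^ 2 < s' → R s x s' = 0) → (∀ s x s', |R s x s'| ≤ |s'|) →
    ∀ ε : ℝ, 0 < ε →
    ∃ ℓ : ℝ, 0 < ℓ ∧ ∀ L : ℝ, ∃ N₀ : ℕ, ∀ N : ℕ, N₀ ≤ N → ∀ s ∈ Set.Icc 0 t, ∀ r r' : ℝ,
      s ≤ r → r + ℓ * ((N : ℝ) + 1) ^ (-(1 / 3 : ℝ)) ≤ r' → r' ≤ s + L * ((N : ℝ) + 1) ^ (-(1 / 3 : ℝ)) →
      (let P := localGibbsLaw σ a₀ u₀ θ₀ N (Φ N)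
       let W := fun (i : Fin (N + 1)) (s r : ℝ) (z : Config (N + 1) (Fin 3) T3) =>
         ((Φ N).flow r z i).2 - u s ((Φ N).flow r z i).1
       let F := fun (i : Fin (N + 1)) (s r : ℝ) (z : Config (N + 1) (Fin 3) T3) =>
         (R s ((Φ N).flow r z i).1 (‖W i s r z‖ ^ 2)) • W i s r z
       ∫ z, ((N : ℝ) + 1)⁻¹ * ∑ i : Fin (N + 1), inner ℝ (F i s r z) (F i s r' z) ∂P ≤ ε)

/-! ## §6 The reduction: autocorrelation decay implies the bounded odd window LLN -/

/-- Elementary: `x ≤ ε/2 + x²/(2ε)` for `ε > 0` (AM–GM; used instead of Jensen to pass from `L²` to `L¹`). [folklore] -/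
theorem le_half_add_sq_div {x e : ℝ} (he : 0 < e) : x ≤ e / 2 + (2 * e)⁻¹ * x ^ 2 := by
  have h : 0 ≤ (x - e) ^ 2 / (2 * e) := by positivity
  have h2 : (x - e) ^ 2 / (2 * e) = e / 2 + (2 * e)⁻¹ * x ^ 2 - x := by field_simp; ring
  linarith [h, h2]

/-- Elementary: `((m)⁻¹ Σ_{i<m} a_i)² ≤ (m)⁻¹ Σ a_i²` for `m = N + 1` (Cauchy–Schwarz). [folklore] -/
theorem sq_avg_le_avg_sq (N : ℕ) (a : Fin (N + 1) → ℝ) :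
    (((N : ℝ) + 1)⁻¹ * ∑ i, a i) ^ 2 ≤ ((N : ℝ) + 1)⁻¹ * ∑ i, a i ^ 2 := by
  have hN : (0 : ℝ) < (N : ℝ) + 1 := by positivity
  have h := sq_sum_le_card_mul_sum_sq (s := (Finset.univ : Finset (Fin (N + 1)))) (f := a)
  simp only [Finset.card_univ, Fintype.card_fin, Nat.cast_add, Nat.cast_one] at h
  rw [mul_pow]
  calc ((N : ℝ) + 1)⁻¹ ^ 2 * (∑ i, a i) ^ 2 ≤ ((N : ℝ) + 1)⁻¹ ^ 2 * (((N : ℝ) + 1) * ∑ i, a i ^ 2) :=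
        mul_le_mul_of_nonneg_left h (by positivity)
    _ = _ := by field_simp

/-- **THE REDUCTION `OddPeculiarAutocorrelationDecay → BoundedOddWindowLLN`.** Given `ε`: lag `ℓ = ℓ(ε²/2)`,
`τ₀ := ℓ + 4ℓ|V|⁶/ε²`, `N₀ := N₀(L := τ)`; then with `w = τ(N+1)^{-1/3}`, `δ = ℓ(N+1)^{-1/3}`, `P = localGibbsLaw` (probability,
`σ ≤ 1/2`): `E f ≤ ε/2 + E f²/(2ε)`, `f² ≤ (N+1)⁻¹Σ_i‖q̄_i‖²`, `‖q̄_i‖² = w⁻² ∫∫ ⟪F_i(r), F_i(r′)⟫` on the good set (§3 along §1),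
Fubini, and the two-time expectation is `≤ ε²/2` off the band `|r − r′| < δ` (hypothesis, both orders) and `≤ |V|⁶` on it
(measure `≤ 2δw`, §4): `E f² ≤ ε²/2 + 2|V|⁶ℓ/τ ≤ ε²`. [folklore] -/
theorem boundedOddWindowLLN_of_autocorrelationDecay : OddPeculiarAutocorrelationDecay → BoundedOddWindowLLN := by
  intro H a₀ θ₀ u₀ ha hθ hu ha0 hθ0
  obtain ⟨σ₁, hσ₁, H1⟩ := H a₀ θ₀ u₀ ha hθ hu ha0 hθ0
  refine ⟨min σ₁ (1 / 2), lt_min hσ₁ (by norm_num), ?_⟩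
  intro σ hσ hσlt T ρ θ u hE Φ htie t ht V R hRm hR0 hR ε hε
  have hσ1 : σ < σ₁ := hσlt.trans_le (min_le_left _ _)
  have hσh : σ ≤ 1 / 2 := (hσlt.trans_le (min_le_right _ _)).le
  -- the autocorrelation decay at accuracy `ε²/2`
  obtain ⟨ℓ, hℓ, Hℓ⟩ := H1 σ hσ hσ1 T ρ θ u hE Φ htie t ht V R hRm hR0 hR (ε ^ 2 / 2) (by positivity)
  set B : ℝ := |V| ^ 3 with hBdef
  have hB0 : 0 ≤ B := by positivity
  refine ⟨ℓ + 4 * ℓ * B ^ 2 / ε ^ 2, by positivity, fun τ hτ => ?_⟩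
  obtain ⟨N₀, HN⟩ := Hℓ τ
  refine ⟨N₀, fun N hN s hs => ?_⟩
  dsimp only
  -- constants
  set c : ℝ := ((N : ℝ) + 1) ^ (-(1 / 3 : ℝ)) with hcdef
  have hc : 0 < c := Real.rpow_pos_of_pos (by positivity) _
  have hℓτ : ℓ ≤ τ := le_trans (le_add_of_nonneg_right (by positivity)) hτ
  have hτ4 : 4 * ℓ * B ^ 2 / ε ^ 2 ≤ τ := le_trans (le_add_of_nonneg_left hℓ.le) hτ
  have hτpos : 0 < τ := hℓ.trans_le hℓτ
  have hw : 0 < τ * c := mul_pos hτpos hc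
  have hδ : 0 < ℓ * c := mul_pos hℓ hc
  have hNpos : (0 : ℝ) < (N : ℝ) + 1 := by positivity
  set P := localGibbsLaw σ a₀ u₀ θ₀ N (Φ N) with hPdef
  haveI : IsProbabilityMeasure P := isProbabilityMeasure_localGibbsLaw ha hθ hu ha0 hθ0 hσh N (Φ N)
  have hPgood : ∀ᵐ z ∂P, z ∈ (Φ N).good := ae_mem_good_localGibbsLaw σ a₀ u₀ θ₀ N (Φ N)
  have hus : Continuous (u s) := (hE.smooth_velocity.isSmooth_slice ⟨hs.1, hs.2.trans_lt ht.2⟩).continuous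
  have hRs : Measurable fun p : T3 × ℝ => R s p.1 p.2 := hRm.comp (measurable_const.prodMk measurable_id)
  -- the observable along the glued flow
  set F : Fin (N + 1) → ℝ → Config (N + 1) (Fin 3) T3 → V3 :=
    fun i r z => oddObs (u s) (R s) (goodFlow (Φ N) r z i) with hFdef
  have hFB : ∀ i r z, ‖F i r z‖ ≤ B := fun i r z => norm_oddObs_le (hR0 s) (hR s) _
  have hFm : ∀ i, Measurable fun p : Config (N + 1) (Fin 3) T3 × ℝ => F i p.2 p.1 := fun i =>
    (measurable_oddObs hus hRs).comp ((measurable_pi_apply i).comp (measurable_goodFlow_prod (Φ N)))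
  -- on the good set the node's functional is `F`
  have hFgood : ∀ z ∈ (Φ N).good, ∀ i r,
      (R s ((Φ N).flow r z i).1 (‖((Φ N).flow r z i).2 - u s ((Φ N).flow r z i).1‖ ^ 2)) •
        (((Φ N).flow r z i).2 - u s ((Φ N).flow r z i).1) = F i r z := fun z hz i r => by
    simp only [hFdef, oddObs, goodFlow_eq_of_mem (Φ N) hz]
  -- the two-time kernel
  set K : Config (N + 1) (Fin 3) T3 → ℝ × ℝ → ℝ :=
    fun z p => ((N : ℝ) + 1)⁻¹ * ∑ i, inner ℝ (F i p.1 z) (F i p.2 z) with hKdef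
  have hKm : Measurable (Function.uncurry K) := by
    refine measurable_const.mul (Finset.measurable_sum _ fun i _ => ?_)
    exact ((hFm i).comp (measurable_fst.prodMk measurable_snd.fst)).inner
      ((hFm i).comp (measurable_fst.prodMk measurable_snd.snd))
  have hKB : ∀ z p, ‖K z p‖ ≤ B ^ 2 := fun z p => by
    rw [Real.norm_eq_abs, hKdef]
    dsimp only
    rw [abs_mul, abs_of_pos (inv_pos.2 hNpos)]
    calc ((N : ℝ) + 1)⁻¹ * |∑ i, inner ℝ (F i p.1 z) (F i p.2 z)| ≤ ((N : ℝ) + 1)⁻¹ * ∑ i : Fin (N + 1), B ^ 2 := by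
          refine mul_le_mul_of_nonneg_left ((Finset.abs_sum_le_sum_abs _ _).trans (Finset.sum_le_sum fun i _ => ?_))
            (inv_nonneg.2 hNpos.le)
          exact (abs_real_inner_le_norm _ _).trans (by rw [sq]; exact mul_le_mul (hFB _ _ _) (hFB _ _ _) (norm_nonneg _) hB0)
      _ = B ^ 2 := by
          rw [Finset.sum_const, Finset.card_univ, Fintype.card_fin, nsmul_eq_mul]; push_cast; field_simp
  -- the measure on the square
  set μI : Measure ℝ := volume.restrict (Ioc s (s + τ * c)) with hμIdef
  set ν : Measure (ℝ × ℝ) := μI.prod μI with hνdef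
  have hμIu : μI univ = ENNReal.ofReal (τ * c) := by
    rw [hμIdef, Measure.restrict_apply_univ, Real.volume_Ioc]; ring_nf
  have hνu : ν.real univ = (τ * c) * (τ * c) := by
    rw [measureReal_def, hνdef, ← univ_prod_univ, Measure.prod_prod, hμIu, ENNReal.toReal_mul,
      ENNReal.toReal_ofReal hw.le]
  -- integrability on `P × ν`
  have hKint : Integrable (Function.uncurry K) (P.prod ν) :=
    (integrable_const (B ^ 2)).mono' hKm.aestronglyMeasurable (ae_of_all _ fun q => hKB q.1 q.2)
  -- (ii) the pathwise identity, for every configuration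
  have hpath : ∀ z, ((N : ℝ) + 1)⁻¹ * ∑ i, ‖(τ * c)⁻¹ • ∫ r in s..(s + τ * c), F i r z‖ ^ 2 =
      (τ * c)⁻¹ ^ 2 * ∫ p, K z p ∂ν := fun z =>
    mul_sum_sq_norm_windowAvg_eq (fun i => (hFm i).comp (measurable_const.prodMk measurable_id))
      (fun i r => hFB i r z) hw.le _
  have hpath0 : ∀ z, 0 ≤ (τ * c)⁻¹ ^ 2 * ∫ p, K z p ∂ν := fun z => by
    rw [← hpath z]; positivity
  -- (iv) the two-time expectation: `≤ ε²/2` off the band, `≤ B²` on it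
  set D : Set (ℝ × ℝ) := {p | |p.1 - p.2| < ℓ * c} with hDdef
  have hDm : MeasurableSet D :=
    (isOpen_lt (continuous_abs.comp (continuous_fst.sub continuous_snd)) continuous_const).measurableSet
  have hfar : ∀ r r', s ≤ r → r + ℓ * c ≤ r' → r' ≤ s + τ * c → ∫ z, K z (r, r') ∂P ≤ ε ^ 2 / 2 := by
    intro r r' h1 h2 h3
    have h := HN N hN s hs r r' h1 h2 h3
    dsimp only at h
    refine le_of_eq_of_le (integral_congr_ae ?_) h
    filter_upwards [hPgood] with z hz
    simp only [hKdef, ← hFgood z hz]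
  have htwo : ∀ p : ℝ × ℝ, p ∈ Ioc s (s + τ * c) ×ˢ Ioc s (s + τ * c) →
      ∫ z, K z p ∂P ≤ ε ^ 2 / 2 + D.indicator (fun _ => B ^ 2) p := by
    rintro ⟨r, r'⟩ ⟨⟨hr1, hr2⟩, ⟨hr1', hr2'⟩⟩
    by_cases hD1 : ((r, r') : ℝ × ℝ) ∈ D
    · rw [indicator_of_mem hD1]
      have : ∫ z, K z (r, r') ∂P ≤ B ^ 2 := by
        refine (le_abs_self _).trans ((Real.norm_eq_abs _).symm.trans_le ?_)
        calc ‖∫ z, K z (r, r') ∂P‖ ≤ B ^ 2 * P.real univ :=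
              norm_integral_le_of_norm_le_const (ae_of_all _ fun z => hKB z _)
          _ = B ^ 2 := by rw [probReal_univ, mul_one]
      linarith [sq_nonneg ε]
    · rw [indicator_of_notMem hD1, add_zero]
      have hD2 : ℓ * c ≤ |r - r'| := not_lt.1 hD1
      rcases le_or_gt r r' with hle | hlt
      · -- `r + δ ≤ r'`
        have : r + ℓ * c ≤ r' := by
          rw [abs_sub_comm, abs_of_nonneg (sub_nonneg.2 hle)] at hD2; linarith
        exact hfar r r' hr1.le this hr2'
      · -- `r' + δ ≤ r`: symmetry of the kernel
        have : r' + ℓ * c ≤ r := by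
          rw [abs_of_pos (sub_pos.2 hlt)] at hD2; linarith
        have hsymm : ∀ z, K z (r, r') = K z (r', r) := fun z => by
          simp only [hKdef, real_inner_comm]
        simp_rw [hsymm]
        exact hfar r' r hr1'.le this hr2
  -- integrate (iv) over the square
  have hsq : ∫ p, (∫ z, K z p ∂P) ∂ν ≤ ε ^ 2 / 2 * ((τ * c) * (τ * c)) + B ^ 2 * (2 * (ℓ * c) * (τ * c)) := by
    have hint1 : Integrable (fun p => ∫ z, K z p ∂P) ν := hKint.integral_prod_right
    have hint2 : Integrable (fun p => ε ^ 2 / 2 + D.indicator (fun _ => B ^ 2) p) ν :=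
      (integrable_const _).add ((integrable_const _).indicator hDm)
    have hae : ∀ᵐ p ∂ν, p ∈ Ioc s (s + τ * c) ×ˢ Ioc s (s + τ * c) := by
      rw [hνdef, hμIdef, Measure.prod_restrict]
      exact ae_restrict_mem (measurableSet_Ioc.prod measurableSet_Ioc)
    calc ∫ p, (∫ z, K z p ∂P) ∂ν ≤ ∫ p, (ε ^ 2 / 2 + D.indicator (fun _ => B ^ 2) p) ∂ν :=
          integral_mono_ae hint1 hint2 (hae.mono htwo)
      _ = ε ^ 2 / 2 * ν.real univ + B ^ 2 * ν.real D := by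
          rw [integral_add (integrable_const _) ((integrable_const _).indicator hDm), integral_const,
            integral_indicator_const _ hDm, smul_eq_mul, smul_eq_mul, mul_comm, mul_comm (ν.real D)]
      _ ≤ _ := by
          rw [hνu]
          refine add_le_add le_rfl (mul_le_mul_of_nonneg_left ?_ (by positivity))
          exact ENNReal.toReal_le_of_le_ofReal (by positivity) (prod_band_le s (τ * c) hδ.le)
  -- (iii) Fubini: `E[(N+1)⁻¹ Σ ‖q̄_i‖²] ≤ ε²`
  have hEsq : ∫ z, (τ * c)⁻¹ ^ 2 * ∫ p, K z p ∂ν ∂P ≤ ε ^ 2 := by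
    rw [integral_const_mul, integral_integral_swap hKint]
    calc (τ * c)⁻¹ ^ 2 * ∫ p, ∫ z, K z p ∂P ∂ν
          ≤ (τ * c)⁻¹ ^ 2 * (ε ^ 2 / 2 * ((τ * c) * (τ * c)) + B ^ 2 * (2 * (ℓ * c) * (τ * c))) :=
          mul_le_mul_of_nonneg_left hsq (by positivity)
      _ = ε ^ 2 / 2 + 2 * B ^ 2 * ℓ / τ := by field_simp
      _ ≤ ε ^ 2 / 2 + ε ^ 2 / 2 := by
          refine add_le_add le_rfl ?_
          rw [div_le_iff₀ hτpos]
          rw [div_le_iff₀ (by positivity)] at hτ4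
          linarith
      _ = ε ^ 2 := by ring
  -- (i) assembly: AM–GM, Cauchy–Schwarz, and the a.e. identification with `F`
  have hint3 : Integrable (fun z => (τ * c)⁻¹ ^ 2 * ∫ p, K z p ∂ν) P := (hKint.integral_prod_left).const_mul _
  have hpt : ∀ z ∈ (Φ N).good,
      ENNReal.ofReal (((N : ℝ) + 1)⁻¹ * ∑ i : Fin (N + 1), ‖(τ * c)⁻¹ • ∫ r in s..(s + τ * c),
        (R s ((Φ N).flow r z i).1 (‖((Φ N).flow r z i).2 - u s ((Φ N).flow r z i).1‖ ^ 2)) •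
          (((Φ N).flow r z i).2 - u s ((Φ N).flow r z i).1)‖) ≤
      ENNReal.ofReal (ε / 2) + ENNReal.ofReal ((2 * ε)⁻¹ * ((τ * c)⁻¹ ^ 2 * ∫ p, K z p ∂ν)) := by
    intro z hz
    simp_rw [hFgood z hz]
    refine le_trans (ENNReal.ofReal_le_ofReal ((le_half_add_sq_div hε).trans (add_le_add le_rfl
      (mul_le_mul_of_nonneg_left ((sq_avg_le_avg_sq N _).trans (hpath z).le) (by positivity))))) ?_
    exact ENNReal.ofReal_add_le
  calc _ ≤ ∫⁻ z, ENNReal.ofReal (ε / 2) + ENNReal.ofReal ((2 * ε)⁻¹ * ((τ * c)⁻¹ ^ 2 * ∫ p, K z p ∂ν)) ∂P :=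
        lintegral_mono_ae (hPgood.mono hpt)
    _ = ENNReal.ofReal (ε / 2) + ENNReal.ofReal ((2 * ε)⁻¹) * ∫⁻ z, ENNReal.ofReal ((τ * c)⁻¹ ^ 2 * ∫ p, K z p ∂ν) ∂P := by
        rw [lintegral_add_left measurable_const, lintegral_const, measure_univ, mul_one]
        simp_rw [ENNReal.ofReal_mul (inv_nonneg.2 (by positivity : (0 : ℝ) ≤ 2 * ε))]
        rw [lintegral_const_mul' _ _ ENNReal.ofReal_ne_top]
    _ = ENNReal.ofReal (ε / 2) + ENNReal.ofReal ((2 * ε)⁻¹) * ENNReal.ofReal (∫ z, (τ * c)⁻¹ ^ 2 * ∫ p, K z p ∂ν ∂P) := by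
        rw [ofReal_integral_eq_lintegral_ofReal hint3 (ae_of_all _ hpath0)]
    _ ≤ ENNReal.ofReal (ε / 2) + ENNReal.ofReal ((2 * ε)⁻¹) * ENNReal.ofReal (ε ^ 2) :=
        add_le_add le_rfl (mul_le_mul_right (ENNReal.ofReal_le_ofReal hEsq) _)
    _ = ENNReal.ofReal ε := by
        rw [← ENNReal.ofReal_mul (by positivity), ← ENNReal.ofReal_add (by positivity) (by positivity)]
        congr 1
        field_simp
        ring

end Summit.AtomisticToContinuum.HydrodynamicLimit.Theorems.TransferEntropyClockOddWindowLLNNode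

end
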